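import Summits.QuantumFields.BalabanUV.T4Continuum.Support.ShellMeasureAverageLandauCorrection
import Summits.QuantumFields.BalabanUV.T4Continuum.Support.ShellMeasureLinearizedGammaTLocalEnd

/-!
# `T4Continuum.ShellMeasureAverageLandauCorrectionLocal` — NE7c-S91 «γ3′ (LR)_j LOCAL», file 4: W-a (Cf) FOR THE PRINTED
# AVERAGE — the Landau-correction binder triple `hC₂`∕`hCq`∕`hCd` for `C̃_V := Q̃_V − DQ̃_V(0)` from PLAQUETTE REGULARITY ON
# THE TWO-BLOCK BOX OF `c` ALONE (leaf-01's `ShellMeasureAverageLandauCorrection.landauCorrection_pair_plaquette`, located)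
(cell `pub-balaban`, sub-cell `t4`, spine estimate NE7c (node U5b); NE7c ROUND-2 crew `t4-ne7c-formalise-*`, seat
`b2b-balaban-t4-ne7c-formalise-leaf-07` gen 8; row S91 of the owner's table `t4/b2b-balaban-t4-ne7c-p1/LEAVES-NE7c-P1.md`
v3.8 (R-ne7cp1-g33-2 (a)); ADDITIVE — imports leaf-01's `ShellMeasureAverageLandauCorrection` (its loop form
`landauCorrection_pair_gammaT` is ALREADY per bond) + file 2 `ShellMeasureLinearizedGammaTLocalEnd` (for `loopsAt_of_box`)
ONLY; [folklore]; 0 `def`, 0 `def … : Prop`, 0 sorry, 0 citations)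

HONEST FRAMING.  Finite four-torus programme, rung (B)+1 only — NOT infinite volume, NOT a mass gap, NOT the Clay
problem, NOT summit progress; (B), `BetaPertHyp`, (B^μ) not consumed.  NE7c (`T4IndicatorShell.ShellWeightBound`) is
NOT PRINTED and NOT PROVED; «NE7c ⇐ the named binders» (trigger c3).  The plaquette regularity of Bałaban's backgrounds
(B11 (19)–(21) ∕ B14 (2.16)–(2.17); [B12] p. 254 TYPE) stays a DISPLAYED binder — LOCATED here (two-block box instead of
all of `ℤᵈ`), not discharged; the identification of END-II's `Cf` slot with this `C̃` is the [dict] reading (node O).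
NOTHING in the countdown moves; spine PROVED 0∕9.  HONEST DEPENDENCY (cell, verbatim): continuum YM on T⁴ ⇐ BetaPertH ∧
nine spine estimates (0/9 proved); BetaPertH ⇐ (D1) ∧ (D4) ∧ CAP+tail; G-an2-4 gates asym, D1 and NE2/3/4.

THE POINT (same audit as files 1–3, F-ne7cleaf07g8-1).  `landauCorrection_pair_plaquette` (the plaquette form of the
W-a (Cf) supplier for the printed average) asks `h44 : ∀ z p i j, ‖V z (∂p) − 1‖ ≤ ε₀` for EVERY plaquette of `ℤᵈ`, while
the objects read `V z` on `B(c₋) ∪ B(c₊)` only and the module's own loop form `landauCorrection_pair_gammaT` is already AT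
`c`.  **`landauCorrection_pair_plaquette_box`**: the SAME triple from the LOCATED binder `h44c` (plaquettes with all corners
in `[L c₋, L c₋ + pairTop L c.2]`), ONE call with file 2's `loopsAt_of_box`; `h44c` is read off the term's co-tests on
`□^{∼4}` by file 2's `h44c_of_cotests`; the global form is the special case `P := univ`.
-/

noncomputable section

open Set Metric Function

namespace Summit.QuantumFields.BalabanUV.T4Continuum.ShellMeasureAverageLandauCorrectionLocal

open Literature.MathematicalPhysics.QuantumFieldTheory.Balaban1983to89
open Literature.MathematicalPhysics.QuantumLattice (ZdEdge blockBase plaquetteHolonomyZd)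
open B8Lemma1NonAbelian (pairTop omegaC_nonneg)
open B12PlaquetteLoop267 (thresholds_of_small)
open B7BlockGeometry (qppBonds)
open Summit.QuantumFields.BalabanUV.Beta.LinearizingChange267FromQ (nonlin Mq)
open ShellMeasureLinearizedGammaT (QtΓ)
open ShellMeasureLinearizedGammaTLocal (loopsAt_of_box h44c_of_cotests)
open ShellMeasureAverageLandauCorrection (landauCorrection_pair_gammaT)

variable {d : ℕ} {𝔸 : Type*} [NormedRing 𝔸] [NormedAlgebra ℂ 𝔸] [CompleteSpace 𝔸] [NormOneClass 𝔸] {L : ℕ}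
  {c : ZdEdge d}

/-- **THE LANDAU-CORRECTION TRIPLE FROM PLAQUETTE REGULARITY ON THE TWO-BLOCK BOX OF `c` ALONE**: for unit-bounded
exterior-indexed backgrounds with `‖V z (∂p) − 1‖ ≤ ε₀` for the plaquettes with all corners in `[L c₋, L c₋ + pairTop L c.2]`
(nothing asked elsewhere), `1 ≤ d`, `24·d·L^{d+1}·ε₀ < 1`: with `Cf z := nonlin (QtΓ L (V z) c)`, `R_C := 1∕(2816(d+1)L)`,
`C₂ := Mq R_C 1` — `0 ≤ C₂`, the quadratic bound on `‖Z‖ < R_C`, holomorphy on `ball 0 R_C`.  ONE call of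
`landauCorrection_pair_gammaT` (per bond) with file 2's `loopsAt_of_box`. [folklore] -/
theorem landauCorrection_pair_plaquette_box (hL : 0 < L) (hd : 1 ≤ d) {Z : Type*} {V : Z → ZdEdge d → 𝔸ˣ}
    (hV : ∀ z b, ‖((V z b : 𝔸ˣ) : 𝔸)‖ ≤ 1) (hV' : ∀ z b, ‖(((V z b)⁻¹ : 𝔸ˣ) : 𝔸)‖ ≤ 1) {ε₀ : ℝ} (hε₀ : 0 ≤ ε₀)
    (hsmall : 24 * (d : ℝ) * (L : ℝ) ^ (d + 1) * ε₀ < 1)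
    (h44c : ∀ z (p : Fin d → ℤ) (i j : Fin d), i ≠ j → blockBase L c.1 ≤ p →
      p + Pi.single i 1 + Pi.single j 1 ≤ blockBase L c.1 + pairTop L c.2 →
      ‖((plaquetteHolonomyZd (V z) p i j : 𝔸ˣ) : 𝔸) - 1‖ ≤ ε₀) :
    0 ≤ Mq (1 / (2816 * ((d : ℝ) + 1) * L)) 1 ∧
      (∀ z, ∀ Z : ↥(qppBonds L c) → 𝔸, ‖Z‖ < 1 / (2816 * ((d : ℝ) + 1) * L) →
        ‖nonlin (QtΓ L (V z) c) Z‖ ≤ Mq (1 / (2816 * ((d : ℝ) + 1) * L)) 1 * ‖Z‖ ^ 2) ∧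
      ∀ z, DifferentiableOn ℂ (nonlin (QtΓ L (V z) c)) (ball 0 (1 / (2816 * ((d : ℝ) + 1) * L))) :=
  landauCorrection_pair_gammaT hL hV hV' (omegaC_nonneg hL hd hε₀) (thresholds_of_small hL hd hε₀ hsmall).1
    fun z => loopsAt_of_box hL (V z) (hV z) (hV' z) hε₀ c (h44c z)

/-- **… READ OFF ANY CO-TESTED PLAQUETTE SET `P ⊇ box(c)`** (at a live slot: the unit plaquettes of `□^{∼4}`; file 2
`h44c_of_cotests`).  The GLOBAL form `landauCorrection_pair_plaquette` is the case `P := univ`. [folklore] -/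
theorem landauCorrection_pair_plaquette_of_cotests (hL : 0 < L) (hd : 1 ≤ d) {Z : Type*} {V : Z → ZdEdge d → 𝔸ˣ}
    (hV : ∀ z b, ‖((V z b : 𝔸ˣ) : 𝔸)‖ ≤ 1) (hV' : ∀ z b, ‖(((V z b)⁻¹ : 𝔸ˣ) : 𝔸)‖ ≤ 1) {ε₀ : ℝ} (hε₀ : 0 ≤ ε₀)
    (hsmall : 24 * (d : ℝ) * (L : ℝ) ^ (d + 1) * ε₀ < 1) {P : Set (Fin d → ℤ)}
    (hP : ∀ p : Fin d → ℤ, ∀ i j : Fin d, i ≠ j → blockBase L c.1 ≤ p →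
      p + Pi.single i 1 + Pi.single j 1 ≤ blockBase L c.1 + pairTop L c.2 → p ∈ P)
    (hco : ∀ z, ∀ p ∈ P, ∀ i j : Fin d, i ≠ j → ‖((plaquetteHolonomyZd (V z) p i j : 𝔸ˣ) : 𝔸) - 1‖ ≤ ε₀) :
    0 ≤ Mq (1 / (2816 * ((d : ℝ) + 1) * L)) 1 ∧
      (∀ z, ∀ Z : ↥(qppBonds L c) → 𝔸, ‖Z‖ < 1 / (2816 * ((d : ℝ) + 1) * L) →
        ‖nonlin (QtΓ L (V z) c) Z‖ ≤ Mq (1 / (2816 * ((d : ℝ) + 1) * L)) 1 * ‖Z‖ ^ 2) ∧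
      ∀ z, DifferentiableOn ℂ (nonlin (QtΓ L (V z) c)) (ball 0 (1 / (2816 * ((d : ℝ) + 1) * L))) :=
  landauCorrection_pair_plaquette_box hL hd hV hV' hε₀ hsmall
    fun z => h44c_of_cotests (c := c) hP (hco z)

end Summit.QuantumFields.BalabanUV.T4Continuum.ShellMeasureAverageLandauCorrectionLocal

end
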